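import Literature.NumberTheory.PAdicHodge.EisensteinRootDatum
import Literature.NumberTheory.PAdicHodge.AinfWeierstrassRamifiedTorsionWitness
import Literature.NumberTheory.PAdicHodge.AinfWeierstrassEtaHasseCriterionO
import HarnessLib

/-!
# The coefficient bridge `𝒪_D = ℤ_p[ϖ] → 𝒪_F` for the ramified good models: the (R1) point/η-inputs for curves over `𝒪_D`
# (proofs only)

Topic `Literature/NumberTheory/PAdicHodge`; namespace `Literature.NumberTheory.PAdicHodge`. THEOREMS ONLY. The ring side of road item (R1)
(seat edix-p4 g12: `EisensteinRootDatum`, `AinfRamified`) evaluates formal groups with coefficients in `𝒪_D = AdjoinRoot f ≅ ℤ_p[ϖ]`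
(`EisensteinRoot.Coeff D`, `Coeff.toF : 𝒪_D → F`); the coefficient side (this seat: `AinfWeierstrassRamifiedTorsionNorm/Witness`,
`AinfWeierstrassEtaHasseCriterionO`) is stated for Weierstrass equations over the discrete copy `LTCoeff F` of `𝒪_F`. This file bridges them:

* `EisensteinRoot.Coeff.toF_mem_integer` — **`Coeff.toF` lands in `𝒪_F`** (`‖ϖ‖ ≤ 1`, `‖ℤ_p‖ ≤ 1`, ultrametric), so
  `β := LTCoeff.of ∘ (Coeff.toF).codRestrict 𝒪_F : 𝒪_D →+* LTCoeff F` exists (`EisensteinRoot.exists_coeffToLTCoeff`, stated as an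
  existence of a ring map compatible with `Coeff.toF`; no definition is introduced here);
* **`exists_tatePtO_norm_p_lt_norm_pow_of_map`** and **`mulDefect_evalPt₁_not_mem_span_p_of_map`** — for `W_D` over `𝒪_D` and ANY ring
  map `β : 𝒪_D → LTCoeff F` the point witness `∃ τ ∈ T_pŴ(𝒪_ℂ), ‖p‖ < ‖τ₁‖^p` and the η-transversality `R_p(u) ∉ p𝒪_ℂ` hold for
  `W := W_D.map β` under the reduction hypotheses read on `W` (good supersingular reduction of exact height `2`).

BSD context: route EdixhovenFibreFiveSeven, crux K★ `stmt-BirchSwinnertonDyer-22226`, (R1). BSD is not proved by any of this.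

## References
* J.-P. Serre, *Local Fields* (1979), Ch. I §6 Prop. 18 (totally ramified extensions, `𝒪 = ℤ_p[ϖ]`). [SerreLocalFields1979]
* J.-P. Serre, Invent. Math. 15 (1972), §1.11. [Serre1972]
-/

noncomputable section

open scoped Classical NNReal
open Field ValuativeRel

namespace Literature.NumberTheory.PAdicHodge

open Literature.NumberTheory.GaloisRepresentations
open Literature.NumberTheory.GaloisRepresentations.IsNonarchimedeanLocalField
open Literature.NumberTheory.GaloisRepresentations.LubinTate
open Literature.NumberTheory.EllipticCurves

variable {F : Type} [Field F] [ValuativeRel F] [TopologicalSpace F] [IsNonarchimedeanLocalField F] [CharZero F]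
  {p : ℕ} [Fact p.Prime] {hp : valuation F p < 1} (D : EisensteinRoot F p hp)

namespace EisensteinRoot

omit [CharZero F] in
/-- An element of `F` of `ℂ_F`-norm `≤ 1` lies in `𝒪_F`. [cite: SerreLocalFields1979, Ch. II §1] -/
private theorem mem_integer_of_norm_le_one {x : F} (hx : ‖algebraMap F (CompletedAlgClosure F) x‖ ≤ 1) : x ∈ 𝒪[F] := by
  rw [CompletedAlgClosure.norm_algebraMap] at hx
  exact (Literature.NumberTheory.GaloisRepresentations.IsNonarchimedeanLocalField.norm_le_one_iff F x).mp hx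

/-- **`Coeff.toF` lands in `𝒪_F`**: `𝒪_D = ℤ_p[ϖ] → F` has image in the valuation ring (`‖ℤ_p‖ ≤ 1`, `‖ϖ‖ ≤ 1`).
[cite: SerreLocalFields1979, Ch. I §6 Prop. 18] -/
theorem Coeff.toF_mem_integer (x : D.Coeff) : Coeff.toF D x ∈ 𝒪[F] := by
  induction x using AdjoinRoot.induction_on with
  | ih g =>
    rw [Coeff.toF, AdjoinRoot.lift_mk, Polynomial.eval₂_eq_sum_range]
    refine Subring.sum_mem _ fun i _ => Subring.mul_mem _ ?_ (Subring.pow_mem _ ?_ _)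
    · exact mem_integer_of_norm_le_one (norm_algebraMap_zpToF_le_one hp _)
    · exact mem_integer_of_norm_le_one D.norm_algebraMap_root_le_one

/-- **The bridge `𝒪_D → LTCoeff F` exists**: a ring map `β` with `algebraMap (LTCoeff F) F ∘ β = Coeff.toF` (namely
`LTCoeff.of ∘ codRestrict`). [cite: SerreLocalFields1979, Ch. I §6 Prop. 18] -/
theorem exists_coeffToLTCoeff : ∃ β : D.Coeff →+* LTCoeff F, ∀ x, algebraMap (LTCoeff F) F (β x) = Coeff.toF D x :=
  ⟨(LTCoeff.of F).toRingHom.comp ((Coeff.toF D).codRestrict 𝒪[F] (Coeff.toF_mem_integer D)), fun _ => rfl⟩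

end EisensteinRoot

namespace AinfTop

variable [CharP 𝓀[F] p] (β : D.Coeff →+* LTCoeff F) (WD : WeierstrassCurve D.Coeff)

/-- **The point witness for a curve over `𝒪_D`**, read through any coefficient map `β : 𝒪_D → LTCoeff F`: if `W := W_D ⊗_β 𝒪_F` has
`Δ ∈ 𝒪_Fˣ`, supersingular reduction and exact height `2` at the odd residue characteristic `p`, then some `τ ∈ T_pŴ(𝒪_{ℂ_F})` has
`τ₁ ≠ 0` and `‖p‖ < ‖τ₁‖^p` (`exists_tatePtO_norm_p_lt_norm_pow`). [cite: Serre1972, §1.11] -/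
theorem exists_tatePtO_norm_p_lt_norm_pow_of_map (hp2 : p ≠ 2) (hΔ : IsUnit (WD.map β).Δ)
    (hA : ((WD.map β).map (redCoeff F)).hasseCoeff p = 0)
    (hht : PowerSeries.coeff (p ^ 2) (((WD.map β).map (redCoeff F)).formalMul p) ≠ 0) :
    ∃ τ : TatePtO F (WD.map β) p,
      ((((TateModule.proj p 1 τ).val : (maxNilIdealC F).toIdeal) : CBall F) : CompletedAlgClosure F) ≠ 0 ∧
      ‖(p : CompletedAlgClosure F)‖ <
        ‖((((TateModule.proj p 1 τ).val : (maxNilIdealC F).toIdeal) : CBall F) : CompletedAlgClosure F)‖ ^ p :=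
  exists_tatePtO_norm_p_lt_norm_pow (WD.map β) hp2 hΔ hA hht

/-- **The η-transversality input for a curve over `𝒪_D`**, read through `β : 𝒪_D → LTCoeff F`: for `W := W_D ⊗_β 𝒪_F` with `Δ ∈ 𝒪_Fˣ`
and supersingular reduction at the odd residue characteristic `p`, any integral lift `Rn ∈ 𝒪_F⟦X⟧` of `R_p(W ⊗ F)` satisfies
`R_p(u) ∉ p𝒪_{ℂ_F}` at every `u ∈ 𝔪_{ℂ_F}` with `‖p‖ < ‖u‖^p` (`mulDefect_evalPt₁_not_mem_span_p`). [cite: Serre1972, §1.11] -/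
theorem mulDefect_evalPt₁_not_mem_span_p_of_map (hp2 : p ≠ 2) (hΔ : IsUnit (WD.map β).Δ)
    (hA : ((WD.map β).map (redCoeff F)).hasseCoeff p = 0) {Rn : PowerSeries (LTCoeff F)}
    (hRn : PowerSeries.map (algebraMap (LTCoeff F) F) Rn =
      ((WD.map β).map (algebraMap (LTCoeff F) F)).formalQuasiPeriodMulDefect p)
    (hRn0 : PowerSeries.constantCoeff Rn = 0) (u : (maxNilIdealC F).toIdeal)
    (hpu : ‖(p : CompletedAlgClosure F)‖ < ‖((u : CBall F) : CompletedAlgClosure F)‖ ^ p) :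
    (evalPt₁ (maxNilIdealC F) Rn hRn0 u : CBall F) ∉ Ideal.span {(p : CBall F)} :=
  mulDefect_evalPt₁_not_mem_span_p (WD.map β) hp2 hΔ hA hRn hRn0 u hpu

end AinfTop

end Literature.NumberTheory.PAdicHodge

end
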